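import Summits.HodgeConjecture.HodgeConjecture.Theses.TateCuspKLift
import Literature.AlgebraicGeometry.HodgeTheory.AlgebraicClassesPullback

/-!
# Birth skeleton — crux `KClassPropagates` (stmt-HodgeConjecture-9314), route `TateCuspKLift`

BC3 skeleton (registrar seat `planner-skel-stmt-HodgeConjecture-9314-0`, 2026-08-17) for the rank-3 crux
`Summit.HodgeConjecture.HodgeConjecture.Theses.TateCuspKLift.KClassPropagates` (card E4, "the sideways
step": a rational `(p,p)` class `ξ` on a smooth projective `𝒳 → C` whose restriction to the fibre `X_o`
is a PULLED-BACK algebraic class — `ξ|X_o ∈ PBᵖ(X_o) = ch_p(K₀(X_o) ⊗ ℚ) ⊗ ℂ` — is algebraic on every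
smooth projective fibre `X_t`).

## The cut (three named stubs, composed by `KClassPropagates_of`)

The route's own description of the mechanism — "deform the K-class over the germ of `C` at `o`,
algebraize, read off `ch_p = ξ|X_t` for `t` near `o`, spread along `C`" — is cut at its two seams, on
the tree's real carriers (`pulledBackAlgebraicClasses`, `algebraicClasses`, `fiberOver`, `AlgPoints.pt`):

* `stub_localKLift` (S1, THE BET, research-open: log-Bloch–Esnault–Kerz formal lifting of the K-class at
  a singular fibre + algebraization over an étale neighbourhood, in its fibrewise cohomological shadow):
  if `ξ|X_o ∈ PBᵖ(X_o)` then `ξ|X_t ∈ PBᵖ(X_t)` for every complex point `t` of a Zariski-open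
  neighbourhood `U ∋ o` of the base curve. (The image of an étale neighbourhood is Zariski open and its
  fibres are the `X_t`, so nothing is lost by asking for a Zariski-open `U`; PB-membership, not
  algebraicity, is the right predicate on the possibly singular / reducible fibres near `o`.)
* `stub_fultonPullback` (S2 = the tree's NAMED FACT `HodgeTheory.fulton1998_map_mem_algebraicClasses`,
  Fulton, Intersection Theory, Cor. 19.2 (b); Voisin II Prop. 9.21 (i); unproved in the tree, reduced
  there to graph morphisms): pull-backs of algebraic classes along morphisms of smooth projective
  varieties are algebraic — whence `PBᵖ(X_t) = algebraicClasses X_t p` on a SMOOTH projective fibre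
  (`fulton1998_map_mem_algebraicClasses.mem_algebraicClasses_of_mem_pulledBackAlgebraicClasses`, proved).
* `stub_spreadAlongCurve` (S3, classical spreading for a dominant family: the algebraicity locus of the
  fibre restrictions of a global class is a countable union of Zariski-closed subsets of the smooth
  locus — the tree's DISCHARGED fact `charlesSchnell_algebraicityLocus_iUnion_closed` applied to
  `𝒳|_{C_sm} → C_sm` — and a closed subset of a curve containing the uncountably many complex points of
  a non-empty open set is everything): if `ξ|X_t` is algebraic on every smooth projective fibre over a
  non-empty Zariski-open `U ⊆ C`, it is algebraic on every smooth projective fibre.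

`KClassPropagates_of : S1 → S2 → S3 → KClassPropagates` is proved below (no `sorry`): S1 gives the open
`U ∋ o`, S2 turns PB-membership into algebraicity on the smooth projective fibres over `U`, S3 spreads.

## Honesty box (read with the item's refuter notes)

* MIS-SCOPING INHERITED, AND WHERE. As typed the crux does not ask `f` to be dominant; the refuters'
  certificate `KClassDegenerate.lean` (evidence on stmt-9314: `f` constant through `c₀ ≠ o` makes
  `X_o = ∅`, the PB hypothesis vacuous and `X_{c₀} ≅ 𝒳`) shows crux ⟺ HC. A skeleton of the crux AS
  FILED must carry that strength somewhere; here it sits ENTIRELY in S3 (take `U = C ∖ {c₀}`: only empty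
  fibres over `U`, conclusion = HC for `𝒳`), exactly as in the crux, while S1 is HC-FREE on the
  degenerate instances (for `f` constant through `c₀ ≠ o` the open `U := C ∖ {c₀} ∋ o` has only empty
  fibres; for `f` constant through `o` take `U := C`). Under the pending repair of the route
  (`Function.Surjective f.left.base`, restatement package attached to the item 2026-08-15) the SAME three
  stubs with that binder threaded are: S1 the open E4 step, S2 Fulton, S3 a classical theorem.
* NO STUB IS REFUTABLE SHORT OF ¬HC: S1 and S3 are implied by HC (plus generic smoothness / Stein
  factorisation bookkeeping), S2 is a theorem in print. None is the crux or the summit in costume: the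
  BC3 probes `stub → KClassPropagates` and `stub → HodgeConjecture` by
  `first | exact? | simpa | aesop` fail for all three (registrar's `bc/probe_*.lean`, quoted in
  `Lines/birth.md`); conversely `KClassPropagates → S1` needs generic smoothness and Stein factorisation
  (reducible nearby fibres), `KClassPropagates → S3` needs a smooth fibre inside `U`.
* A rigidity-style cut ("a global algebraic class agreeing with `ξ` on one smooth fibre agrees on all")
  was REJECTED: without dominance it is false (the isolated smooth fibre `X_{c₀}` of a constant `f`
  versus its empty neighbours), so it cannot be a stub of the crux as filed.
* Disproof used: none — `Cruxes/KClassPropagates/` had no `Disproof.lean` when this was written;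
  `ledger negatives --problem HodgeConjecture` (3 entries: MilnorKExponential symbol lift, Fermat K3
  exhaustion, E-line connectivity) contains nothing of the shape of S1–S3.
-/

set_option linter.dupNamespace false

open CategoryTheory AlgebraicGeometry
open Literature.AlgebraicGeometry.Motives Literature.AlgebraicGeometry.HodgeTheory
open Summit.HodgeConjecture.HodgeConjecture.Theses.TateCuspKLift

namespace Summit.HodgeConjecture.HodgeConjecture.Cruxes.KClassPropagates.Birth

/-! ## §1 Statements of the stubs -/

/-- Statement of STUB S1 — **LOCAL K-LIFT AT THE CUSP** (the bet; card E4 proper: log-BEK formal lifting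
of the K-class `v ∈ K₀(X_o) ⊗ ℚ` with `ch_p(v) = ξ|X_o` — unobstructed because `ξ` is globally of type
`(p,p)` — followed by algebraization of the formal K-class over an étale neighbourhood of `o`; stated
through its fibrewise shadow on the tree's carriers). For `f : 𝒳 → C` (`𝒳` smooth projective of
dimension `N`, `C` a smooth projective curve), a complex point `o` of `C` and a rational `(p,p)` class
`ξ` on `𝒳`: if `ξ|X_o` is a pulled-back algebraic class on the fibre `X_o`, then there is a Zariski-open
`U ⊆ C` containing `o` such that `ξ|X_t` is a pulled-back algebraic class on `X_t` for every complex
point `t` of `U`. Why it might fail: log-BEK at an snc / arbitrary singular fibre is unproved and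
algebraization of formal K-classes fails in general (Bloch–Esnault–Kerz 2014, Thm 2, Conj 4, App. A);
as typed it is implied by HC (generic smoothness + Stein factorisation), so it dies only with HC. -/
def LocalKLift : Prop :=
  ∀ (N p : ℕ) (𝒳 C : SchemeOver ℂ) (f : 𝒳 ⟶ C) (o : AlgPoints C ℂ),
    IsSmoothProjective N 𝒳 → IsSmoothProjective 1 C →
    ∀ ξ : complexBetti 𝒳 (2 * p), IsRationalClass ξ → IsOfHodgeType N 𝒳 (2 * p) p p ξ →
    (complexBetti.map (fiberι f o) (2 * p)).hom ξ ∈ pulledBackAlgebraicClasses (fiberOver f o) p →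
    ∃ U : Set C.left, IsOpen U ∧ o.pt ∈ U ∧
      ∀ t : AlgPoints C ℂ, t.pt ∈ U →
        (complexBetti.map (fiberι f t) (2 * p)).hom ξ ∈ pulledBackAlgebraicClasses (fiberOver f t) p

/-- Statement of STUB S3 — **SPREADING ALONG THE CURVE** (classical for dominant `f`: restrict `f` to its
smooth locus `C_sm`, a smooth projective family over a smooth irreducible quasi-projective curve; by the
discharged fact `charlesSchnell_algebraicityLocus_iUnion_closed` the algebraicity locus of `ξ` there is
`⋃ⱼ Wⱼ(ℂ)` with `Wⱼ ⊆ C_sm` Zariski-closed; it contains the uncountably many complex points of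
`U ∩ C_sm`, so some `Wⱼ` is infinite, i.e. `Wⱼ = C_sm`). For `f : 𝒳 → C` as above and a rational
`(p,p)` class `ξ` on `𝒳`: if `ξ|X_t` is algebraic on every smooth projective fibre over a non-empty
Zariski-open `U ⊆ C`, then `ξ|X_t` is algebraic on every smooth projective fibre. Why it might fail /
honesty: for NON-dominant `f` (allowed by the crux as filed) `U` may consist of empty fibres only and
the statement is then the Hodge conjecture for `𝒳 ≅ X_{c₀}` — S3 carries the crux's known mis-scoping
verbatim and is HC-strength exactly there; with `Function.Surjective f.left.base` it is a theorem. -/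
def SpreadAlongCurve : Prop :=
  ∀ (N p : ℕ) (𝒳 C : SchemeOver ℂ) (f : 𝒳 ⟶ C),
    IsSmoothProjective N 𝒳 → IsSmoothProjective 1 C →
    ∀ ξ : complexBetti 𝒳 (2 * p), IsRationalClass ξ → IsOfHodgeType N 𝒳 (2 * p) p p ξ →
    ∀ U : Set C.left, IsOpen U → U.Nonempty →
    (∀ t : AlgPoints C ℂ, t.pt ∈ U → ∀ n : ℕ, IsSmoothProjective n (fiberOver f t) →
      (complexBetti.map (fiberι f t) (2 * p)).hom ξ ∈ algebraicClasses (fiberOver f t) p) →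
    ∀ (t : AlgPoints C ℂ) (n : ℕ), IsSmoothProjective n (fiberOver f t) →
      (complexBetti.map (fiberι f t) (2 * p)).hom ξ ∈ algebraicClasses (fiberOver f t) p

/-! ## §2 The stubs (the ONLY `sorry`s of this file) -/

/-- STUB S1 (registered): local K-lift at the cusp, `LocalKLift`. -/
theorem stub_localKLift : LocalKLift := by
  sorry

/-- STUB S2 (registered) = the tree's named fact `HodgeTheory.fulton1998_map_mem_algebraicClasses`
(Fulton 1998, Cor. 19.2 (b); Voisin II, Prop. 9.21 (i)): for a `ℂ`-morphism `j : X ⟶ Y` of smooth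
projective varieties, `j^*(algebraicClasses Y p) ⊆ algebraicClasses X p`. Unproved in the tree (reduced
there to graph morphisms, `fulton1998_map_mem_algebraicClasses_iff_graph`); it is what makes
`PBᵖ(X_t) = algebraicClasses X_t p` on a smooth projective fibre. -/
theorem stub_fultonPullback : fulton1998_map_mem_algebraicClasses := by
  sorry

/-- STUB S3 (registered): spreading along the curve, `SpreadAlongCurve`. -/
theorem stub_spreadAlongCurve : SpreadAlongCurve := by
  sorry

/-! ### Name-keyed aliases (the skeleton audit admits a hypothesis of `KClassPropagates_of` iff the head
constant of its type has the short name of a declared stub) -/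
namespace Registered

/-- Alias of `LocalKLift` keyed by the registered stub name. -/
abbrev stub_localKLift : Prop := LocalKLift
/-- Alias of the named fact `fulton1998_map_mem_algebraicClasses` keyed by the registered stub name. -/
abbrev stub_fultonPullback : Prop := fulton1998_map_mem_algebraicClasses
/-- Alias of `SpreadAlongCurve` keyed by the registered stub name. -/
abbrev stub_spreadAlongCurve : Prop := SpreadAlongCurve

end Registered

/-! ## §3 Composition (no `sorry` below this line) -/

/-- **The three stubs imply the crux, BY NAME.** Given a smooth projective fibre `X_t`: S1 turns the
PB-membership of `ξ|X_o` into PB-membership of `ξ|X_{t'}` for all `t'` in an open `U ∋ o`; S2 (Fulton)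
makes these algebraic on the smooth projective fibres over `U`; S3 spreads algebraicity from the smooth
projective fibres over the non-empty open `U` to every smooth projective fibre, in particular `X_t`. -/
theorem KClassPropagates_of (h₁ : Registered.stub_localKLift) (h₂ : Registered.stub_fultonPullback)
    (h₃ : Registered.stub_spreadAlongCurve) : KClassPropagates := by
  intro N p 𝒳 C f o h𝒳 hC ξ hrat hpp hPB t n ht
  -- S1: the pulled-back class at the cusp persists on the fibres over an open neighbourhood `U ∋ o`
  obtain ⟨U, hU, hoU, hPBU⟩ := h₁ N p 𝒳 C f o h𝒳 hC ξ hrat hpp hPB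
  -- S3: spread from the smooth projective fibres over `U` to every smooth projective fibre
  refine h₃ N p 𝒳 C f h𝒳 hC ξ hrat hpp U hU ⟨o.pt, hoU⟩ (fun t' ht'U n' ht' => ?_) t n ht
  -- S2: on the smooth projective fibre `X_{t'}`, pulled-back algebraic classes are algebraic
  exact fulton1998_map_mem_algebraicClasses.mem_algebraicClasses_of_mem_pulledBackAlgebraicClasses
    h₂ ht' (hPBU t' ht'U)

/-- Wiring check: the registered stubs feed the composition as stated (definitional unfolding only). -/
example : KClassPropagates :=
  KClassPropagates_of stub_localKLift stub_fultonPullback stub_spreadAlongCurve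

/-! ## §4 Plumbing sanity (proved): the binders of S3 line up — with `U = univ` its hypothesis is its
conclusion. (Not evidence for S3; it only shows the statement computes on the carriers.) -/
example (p : ℕ) (𝒳 C : SchemeOver ℂ) (f : 𝒳 ⟶ C) (ξ : complexBetti 𝒳 (2 * p))
    (h : ∀ t : AlgPoints C ℂ, t.pt ∈ (Set.univ : Set C.left) → ∀ n : ℕ,
      IsSmoothProjective n (fiberOver f t) →
        (complexBetti.map (fiberι f t) (2 * p)).hom ξ ∈ algebraicClasses (fiberOver f t) p)
    (t : AlgPoints C ℂ) (n : ℕ) (ht : IsSmoothProjective n (fiberOver f t)) :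
    (complexBetti.map (fiberι f t) (2 * p)).hom ξ ∈ algebraicClasses (fiberOver f t) p :=
  h t (Set.mem_univ _) n ht

end Summit.HodgeConjecture.HodgeConjecture.Cruxes.KClassPropagates.Birth
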